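import Summits.CriticalPhenomena.CardyFormulaZ2.Theorems.CardySusyWardWeakHolomorphyReduction

/-!
# The smooth mode of the Kirchhoff defect telescopes: only the sublattice-staggered mode carries the crux

Line `Sketch` of the crux `CardySusyWard.WeakHolomorphy` (stmt-CriticalPhenomena-11292), lead c3 (infrastructure,
`--supports`).  By `weakHolomorphy_iff_weakKirchhoff` the crux is the weak law `δ^{5/3} Σ_p ∂φ(z_p)·K^s_p → 0` for the SIGNED
combination `K^s_p = F(NE)+F(SW)−F(NW)−F(SE)` of the four spin-`1/3` dart observables at the medial vertex `p`; since the
arriving corners are `NE, SW` at a horizontal edge and `NW, SE` at a vertical one, `K^s_p = s_p·(in_p − out_p)` with the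
sublattice sign `s_p = +1 / −1` (horizontal / vertical).  Here the companion UNSTAGGERED pairing is shown to be trivially small:
for EVERY mesh family `Λ` (no admissibility needed) and every smooth compactly supported `ψ`,
`δ^{5/3} Σ_p ψ(z_p)·s_p·K^s_p = δ^{5/3} Σ_p ψ(z_p)·(in_p − out_p) → 0`, indeed `= O(δ^{2/3})`: every dart is arriving at one
of its two medial vertices and leaving at the other, so the twin regrouping (`stub_regroup`) turns the sum into
`½ Σ_{p,k} ±(ψ(z_p) − ψ(z_twin))·F`, each weight `≤ ‖∇ψ‖_∞·δ` (`smoothDivergence_tendsto_zero`).  So the crux's content is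
exactly the sublattice-STAGGERED (h versus v) mode of the divergence of the dart observable — the spin `−5/3` alias
(`Theorems/WeakHolomorphy/Negative/StaggeredBisectorTelescope.lean`), the inter-direction-class coherence of the census.
References: Duminil-Copin–Smirnov arXiv:1109.1549 §8.3; crux workfiles `Cruxes/WeakHolomorphy/{STRATEGY-CENSUS.md §1, Lines/Sketch.md}`.
-/

noncomputable section

namespace Summit.CriticalPhenomena.CardyFormulaZ2.Theorems.WeakHolomorphy.SplitBypass

open scoped BigOperators Topology
open Filter Set MeasureTheory Complex
open _root_.Literature.Probability.LatticeModels
open _root_.Literature.Barriers.CriticalPhenomena (medialCornersAt medialVertexOf)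
open _root_.Literature.Barriers.CriticalPhenomena.HalfCRGreen (twin twin_snd)

/-- The two medial vertices of a corner are at distance `δ/√2 ≤ δ` (`taylorComb_diff`). [folklore] -/
theorem norm_medialPoint_sub_twin_le {δ : ℝ} (hδ : 0 ≤ δ) (p : Site 2 × Fin 2) (k : Fin 4) :
    ‖medialPoint δ (medialVertexOf p) - medialPoint δ (medialVertexOf (twin p.1 p.2 k))‖ ≤ δ := by
  rw [taylorComb_diff, norm_mul]
  have h1 : ‖((δ / 2 : ℂ))‖ = δ / 2 := by
    rw [show ((δ / 2 : ℂ)) = ((δ / 2 : ℝ) : ℂ) by push_cast; ring, Complex.norm_real, Real.norm_of_nonneg (by linarith)]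
  have h2 : ‖(((![1, -1, -1, 1] : Fin 4 → ℝ) k : ℂ) + ((![-1, -1, 1, 1] : Fin 4 → ℝ) k : ℂ) * Complex.I)‖ ≤ 2 := by
    refine (norm_add_le _ _).trans ?_
    rw [norm_mul, Complex.norm_I, mul_one, Complex.norm_real, Complex.norm_real, Real.norm_eq_abs, Real.norm_eq_abs,
      taylorComb_abs_re, taylorComb_abs_im]
    norm_num
  rw [h1]
  nlinarith [norm_nonneg (((![1, -1, -1, 1] : Fin 4 → ℝ) k : ℂ) + ((![-1, -1, 1, 1] : Fin 4 → ℝ) k : ℂ) * Complex.I)]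

/-- The sublattice sign flips along every corner: the twin of a horizontal medial vertex is vertical and conversely
(`twin_snd`). [folklore] -/
theorem stagger_twin (p : Site 2 × Fin 2) (k : Fin 4) :
    (if (twin p.1 p.2 k).2 = 0 then (1 : ℂ) else -1) = -(if p.2 = 0 then (1 : ℂ) else -1) := by
  rw [twin_snd]
  obtain ⟨x, i⟩ := p
  fin_cases i <;> simp

/-- **The unstaggered (smooth) mode of the Kirchhoff defect is `O(δ^{2/3})` after the crux normalisation — for every mesh
family and every smooth compactly supported weight.** With `K^s_p = F(NE)+F(SW)−F(NW)−F(SE)` (`F = bondDartObservable (Λ δ) δ (1/3)`)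
and the sublattice sign `s_p`, `δ^{5/3} Σ_p ψ(z_p)·s_p·K^s_p → 0` as `δ → 0⁺` (twin regrouping: the pairing telescopes to dart
differences of `ψ`, each `≤ ‖∇ψ‖_∞ δ`, over `O(δ⁻²)` darts). Contrast: the crux is the same statement WITHOUT `s_p`
(`weakHolomorphy_iff_weakKirchhoff`). [folklore] -/
theorem smoothDivergence_tendsto_zero (Λ : ℝ → DiscreteDobrushin) (ψ : ℂ → ℂ) (hψ : ContDiff ℝ (⊤ : ℕ∞) ψ)
    (hc : HasCompactSupport ψ) :
    Tendsto (fun δ : ℝ => ((δ ^ ((5:ℝ) / 3) : ℝ) : ℂ) * ∑ᶠ p : Site 2 × Fin 2,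
        ψ (medialPoint δ (medialVertexOf p)) * ((if p.2 = 0 then (1 : ℂ) else -1) *
          (bondDartObservable (Λ δ) δ (1 / 3) (medialCornersAt p.1 p.2 1) +
            bondDartObservable (Λ δ) δ (1 / 3) (medialCornersAt p.1 p.2 3) -
            bondDartObservable (Λ δ) δ (1 / 3) (medialCornersAt p.1 p.2 0) -
            bondDartObservable (Λ δ) δ (1 / 3) (medialCornersAt p.1 p.2 2))))
      (𝓝[>] 0) (𝓝 0) := by
  classical
  set K := tsupport ψ with hKdef
  have hK : IsCompact K := hc.isCompact
  have hKψ : ∀ z ∉ K, ψ z = 0 := fun z hz => image_eq_zero_of_notMem_tsupport hz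
  obtain ⟨B, hB⟩ := (hψ.continuous_fderiv (by simp)).bounded_above_of_compact_support (hc.fderiv (𝕜 := ℝ))
  have hB0 : 0 ≤ B := (norm_nonneg _).trans (hB 0)
  have hdiff : ∀ z, DifferentiableAt ℝ ψ z := fun z => (hψ.differentiable (by simp)).differentiableAt
  have hLip : ∀ x y : ℂ, ‖ψ y - ψ x‖ ≤ B * ‖y - x‖ := fun x y =>
    Convex.norm_image_sub_le_of_norm_fderiv_le (fun z _ => hdiff z) (fun z _ => hB z) convex_univ (mem_univ x) (mem_univ y)
  obtain ⟨CN, hCN⟩ := stub_count K hK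
  have hFd : ∀ δ c, ‖bondDartObservable (Λ δ) δ (1 / 3) c‖ ≤ 1 := fun δ c => Parafermion.norm_bondDartObservable_le_one _ _ _ _
  -- ### the bound at one mesh
  have hbound : ∀ᶠ δ in 𝓝[>] (0:ℝ), ‖((δ ^ ((5:ℝ) / 3) : ℝ) : ℂ) * ∑ᶠ p : Site 2 × Fin 2,
      ψ (medialPoint δ (medialVertexOf p)) * ((if p.2 = 0 then (1 : ℂ) else -1) *
        (bondDartObservable (Λ δ) δ (1 / 3) (medialCornersAt p.1 p.2 1) +
          bondDartObservable (Λ δ) δ (1 / 3) (medialCornersAt p.1 p.2 3) -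
          bondDartObservable (Λ δ) δ (1 / 3) (medialCornersAt p.1 p.2 0) -
          bondDartObservable (Λ δ) δ (1 / 3) (medialCornersAt p.1 p.2 2)))‖ ≤ 2 * B * |CN| * δ ^ ((2:ℝ) / 3) := by
    have E4 : ∀ᶠ δ in 𝓝[>] (0:ℝ), δ ∈ Set.Ioo (0:ℝ) 1 := Ioo_mem_nhdsGT one_pos
    filter_upwards [E4] with δ hδ
    have hδ0 : 0 < δ := hδ.1
    have hδ1 : δ ≤ 1 := hδ.2.le
    obtain ⟨S, hS, hcard⟩ := hCN δ hδ0 hδ1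
    set zp : Site 2 × Fin 2 → ℂ := fun p => medialPoint δ (medialVertexOf p) with hzp
    set Fd : Site 2 × Site 2 → ℂ := fun c => bondDartObservable (Λ δ) δ (1 / 3) c with hFd_def
    set sg : Site 2 × Fin 2 → ℂ := fun p => if p.2 = 0 then (1 : ℂ) else -1 with hsg
    set w : Site 2 × Fin 2 → Fin 4 → ℂ := fun p k => ψ (zp p) * sg p * (-1) ^ (k.val + 1) with hw
    -- the summand at `p` is `Σ_k w(p,k) Fd(c_{p,k})`
    have hsumk : ∀ p, ∑ k : Fin 4, w p k * Fd (medialCornersAt p.1 p.2 k) =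
        ψ (zp p) * (sg p * (Fd (medialCornersAt p.1 p.2 1) + Fd (medialCornersAt p.1 p.2 3) -
          Fd (medialCornersAt p.1 p.2 0) - Fd (medialCornersAt p.1 p.2 2))) := by
      intro p
      simp only [hw, Fin.sum_univ_four, Fin.isValue, Fin.val_zero, Fin.val_one, Fin.val_two,
        show (3 : Fin 4).val = 3 from rfl]
      ring
    have hsupp : ∀ (p : Site 2 × Fin 2) (k : Fin 4), w p k ≠ 0 → p ∈ S ∧ twin p.1 p.2 k ∈ S := by
      intro p k hne
      have hzK : zp p ∈ K := by
        by_contra hz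
        apply hne
        simp [hw, hKψ _ hz]
      refine ⟨hS p (Metric.self_subset_cthickening K hzK), hS _ ?_⟩
      refine Metric.mem_cthickening_of_dist_le _ (zp p) 1 K hzK ?_
      rw [dist_comm, dist_eq_norm]
      exact (norm_medialPoint_sub_twin_le hδ0.le p k).trans hδ1
    have hfin : ∑ᶠ p : Site 2 × Fin 2, ψ (zp p) * (sg p * (Fd (medialCornersAt p.1 p.2 1) +
        Fd (medialCornersAt p.1 p.2 3) - Fd (medialCornersAt p.1 p.2 0) - Fd (medialCornersAt p.1 p.2 2))) =
        ∑ p ∈ S, ∑ k : Fin 4, w p k * Fd (medialCornersAt p.1 p.2 k) := by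
      rw [finsum_eq_sum_of_support_subset _ (s := S) ?_]
      · exact Finset.sum_congr rfl fun p _ => (hsumk p).symm
      · intro p hp
        rw [Function.mem_support] at hp
        have hzK : zp p ∈ K := by
          by_contra hz
          exact hp (by rw [hKψ _ hz, zero_mul])
        exact hS p (Metric.self_subset_cthickening K hzK)
    -- symmetrised weights are `≤ B δ`
    have hR : ∀ p ∈ S, ∀ k : Fin 4, ‖w p k + w (twin p.1 p.2 k) (k + 2)‖ ≤ B * δ := by
      intro p _ k
      have hsym : w p k + w (twin p.1 p.2 k) (k + 2) =
          (-1) ^ (k.val + 1) * sg p * (ψ (zp p) - ψ (zp (twin p.1 p.2 k))) := by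
        simp only [hw, hsg]
        rw [taylorComb_neg_one_pow k, stagger_twin p k]
        ring
      rw [hsym, norm_mul, norm_mul, taylorComb_norm_sign, one_mul]
      have hs1 : ‖sg p‖ = 1 := by simp only [hsg]; split_ifs <;> simp
      rw [hs1, one_mul]
      exact (hLip _ _).trans (mul_le_mul_of_nonneg_left (norm_medialPoint_sub_twin_le hδ0.le p k) hB0)
    have hmaster : ‖∑ p ∈ S, ∑ k : Fin 4, w p k * Fd (medialCornersAt p.1 p.2 k)‖ ≤ 2 * (B * δ) * 1 * S.card :=
      master_norm_bound stub_regroup S w Fd (by positivity) zero_le_one hsupp hR (fun p _ k => hFd δ _)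
    have hcardabs : δ ^ 2 * (S.card : ℝ) ≤ |CN| := hcard.trans (le_abs_self _)
    rw [norm_mul, Complex.norm_real, Real.norm_of_nonneg (Real.rpow_nonneg hδ0.le _), hfin]
    have h53 : δ ^ ((5:ℝ) / 3) = δ ^ ((2:ℝ) / 3) * δ := by
      rw [show (5:ℝ) / 3 = (2:ℝ) / 3 + 1 by norm_num, Real.rpow_add hδ0, Real.rpow_one]
    have hδ2 : δ * δ * (S.card : ℝ) ≤ |CN| := by rw [← sq]; exact hcardabs
    calc δ ^ ((5:ℝ) / 3) * ‖∑ p ∈ S, ∑ k : Fin 4, w p k * Fd (medialCornersAt p.1 p.2 k)‖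
        ≤ δ ^ ((5:ℝ) / 3) * (2 * (B * δ) * 1 * S.card) := mul_le_mul_of_nonneg_left hmaster (Real.rpow_nonneg hδ0.le _)
      _ = 2 * B * δ ^ ((2:ℝ) / 3) * (δ * δ * S.card) := by rw [h53]; ring
      _ ≤ 2 * B * δ ^ ((2:ℝ) / 3) * |CN| := mul_le_mul_of_nonneg_left hδ2 (by positivity)
      _ = 2 * B * |CN| * δ ^ ((2:ℝ) / 3) := by ring
  -- ### `δ^{2/3} → 0`
  have ht0 : Tendsto (fun δ : ℝ => 2 * B * |CN| * δ ^ ((2:ℝ) / 3)) (𝓝[>] (0:ℝ)) (𝓝 0) := by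
    have hc' : Tendsto (fun δ : ℝ => δ ^ ((2:ℝ) / 3)) (𝓝 (0:ℝ)) (𝓝 ((0:ℝ) ^ ((2:ℝ) / 3))) :=
      (Real.continuousAt_rpow_const 0 ((2:ℝ) / 3) (Or.inr (by norm_num))).tendsto
    rw [Real.zero_rpow (by norm_num)] at hc'
    simpa using (hc'.mono_left nhdsWithin_le_nhds).const_mul (2 * B * |CN|)
  exact squeeze_zero_norm' hbound ht0

/-- **Registered one-line form of `smoothDivergence_tendsto_zero`**: the sublattice-sign-corrected (i.e. plain divergence)
pairing of the spin-`1/3` dart observable with any smooth compactly supported weight is `o(δ^{-5/3})` — for every mesh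
family, unconditionally. [folklore] -/
theorem stub_smoothDivergenceTendstoZero : ∀ (Λ : ℝ → DiscreteDobrushin) (ψ : ℂ → ℂ), ContDiff ℝ (⊤ : ℕ∞) ψ → HasCompactSupport ψ → Tendsto (fun δ : ℝ => ((δ ^ ((5:ℝ) / 3) : ℝ) : ℂ) * ∑ᶠ p : Site 2 × Fin 2, ψ (medialPoint δ (medialVertexOf p)) * ((if p.2 = 0 then (1 : ℂ) else -1) * (bondDartObservable (Λ δ) δ (1 / 3) (medialCornersAt p.1 p.2 1) + bondDartObservable (Λ δ) δ (1 / 3) (medialCornersAt p.1 p.2 3) - bondDartObservable (Λ δ) δ (1 / 3) (medialCornersAt p.1 p.2 0) - bondDartObservable (Λ δ) δ (1 / 3) (medialCornersAt p.1 p.2 2)))) (𝓝[>] 0) (𝓝 0) :=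
  fun Λ ψ hψ hc => smoothDivergence_tendsto_zero Λ ψ hψ hc

end Summit.CriticalPhenomena.CardyFormulaZ2.Theorems.WeakHolomorphy.SplitBypass

end
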